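import Mathlib
import Summits.Ventures.PercRepro2.TypedTwoTerminalSplit

/-!
# The two-terminal lemma (blind cell PercRepro2, p2 g3, 2026-08-25; mine-1 §26(e), the lead's
ruling INBOX 3863 (2)) — PART III: the identity

A typed subgraph `H` (edges `L ⊆ F`, both ends in `I ∪ {s, t}`, `I` unmarked and internal) enters
the typed base of the crux kernel exactly as a single `s`–`t` edge of type `k` with the nonnegative
integer multiplicity `c_k` = the number of typed placements of `L` joining `s` and `t` in exactly
`k` fixed copies:
`typedCount_twoTerminal : N(B + H) = Σ_{k ≤ 3} c_k · N(B + s–t(k))`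
(`twoTermCoeff`; `k = 0` the deletion, `k = 3` the contraction). Kernel-agnostic in substance — the
proof uses the kernel only through its 7-coordinate state (`st_twoTerminal`). Subsumes the series
and parallel rules ((R1)–(R3) of `S1-REDUCTION.md`); a reduction of the crux with nonnegative
coefficients (`|F ∖ L ∪ {h₀}| < |F|` for `|L| ≥ 2`).
Tools: the placements grouped by their joined-copy pattern (`sum_placements_pattern`), the
`S₃`-symmetry of the pattern counts (`patCount_swap12/23`, `patCount_eq_coeff`), the weight
grouping (`sum_pattern_weight`), the split (`typedCount_split_finset`) and the transfer
(`conn_twoTerminal` / `st_twoTerminal`).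
-/

namespace Summit.Ventures.PercRepro2

namespace CovForm

namespace TypedRed

namespace TwoTerm

/-! ## Placements grouped by their joined-copy pattern -/

section Pattern

open Classical

variable {V : Type*} {E : Type*} [Fintype E] [DecidableEq E]

/-- Whether `s, t` are joined through the open edges of `a`. -/
noncomputable def joined (ends : E → Sym2 V) (s t : V) (a : Config E) : Bool :=
  decide (Conn ends a s t)

/-- The typed placements of `L`, as triples. -/
def placements (L : Finset E) (τ : E → ℕ) : Finset (Config E × Config E × Config E) :=
  (suppL L ×ˢ suppL L ×ˢ suppL L).filter fun p => IsPlacement L τ p.1 p.2.1 p.2.2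

/-- The joined-copy pattern of a triple. -/
noncomputable def pattern (ends : E → Sym2 V) (s t : V) (p : Config E × Config E × Config E) :
    Bool × Bool × Bool :=
  (joined ends s t p.1, joined ends s t p.2.1, joined ends s t p.2.2)

/-- The number of placements of `L` with a given joined-copy pattern. -/
noncomputable def patCount (ends : E → Sym2 V) (L : Finset E) (τ : E → ℕ) (s t : V)
    (pqr : Bool × Bool × Bool) : ℕ :=
  ((placements L τ).filter fun p => pattern ends s t p = pqr).card

/-- The canonical pattern of weight `k`: the first `k` copies joined. -/
def canon : ℕ → Bool × Bool × Bool
  | 0 => (false, false, false)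
  | 1 => (true, false, false)
  | 2 => (true, true, false)
  | _ => (true, true, true)

/-- **The coefficients of the two-terminal lemma**: `c_k` = the number of typed placements of `L`
joining `s` and `t` in exactly the first `k` copies (by symmetry, in any fixed `k` copies). -/
noncomputable def twoTermCoeff (ends : E → Sym2 V) (L : Finset E) (τ : E → ℕ) (s t : V)
    (k : ℕ) : ℕ :=
  patCount ends L τ s t (canon k)

omit [Fintype E] [DecidableEq E] in
/-- Placements are symmetric under exchanging the first two copies. -/
lemma isPlacement_swap12 {L : Finset E} {τ : E → ℕ} {a b c : Config E} :
    IsPlacement L τ b a c ↔ IsPlacement L τ a b c := by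
  unfold IsPlacement openCount
  constructor <;> intro h e he <;> have := h e he <;> omega

omit [Fintype E] [DecidableEq E] in
/-- Placements are symmetric under exchanging the last two copies. -/
lemma isPlacement_swap23 {L : Finset E} {τ : E → ℕ} {a b c : Config E} :
    IsPlacement L τ a c b ↔ IsPlacement L τ a b c := by
  unfold IsPlacement openCount
  constructor <;> intro h e he <;> have := h e he <;> omega

/-- Membership in `placements`. -/
lemma mem_placements {L : Finset E} {τ : E → ℕ} {p : Config E × Config E × Config E} :
    p ∈ placements L τ ↔
      (p.1 ∈ suppL L ∧ p.2.1 ∈ suppL L ∧ p.2.2 ∈ suppL L) ∧ IsPlacement L τ p.1 p.2.1 p.2.2 := by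
  simp only [placements, Finset.mem_filter, Finset.mem_product]

/-- The pattern count is symmetric under exchanging the first two copies. -/
lemma patCount_swap12 (ends : E → Sym2 V) (L : Finset E) (τ : E → ℕ) (s t : V) (p q r : Bool) :
    patCount ends L τ s t (q, p, r) = patCount ends L τ s t (p, q, r) := by
  unfold patCount
  refine Finset.card_nbij' (fun x => (x.2.1, x.1, x.2.2)) (fun x => (x.2.1, x.1, x.2.2)) ?_ ?_ ?_ ?_
  · rintro ⟨a, b, c⟩ h
    rw [Finset.mem_coe, Finset.mem_filter, mem_placements] at h ⊢
    simp only [pattern, Prod.mk.injEq] at h ⊢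
    exact ⟨⟨⟨h.1.1.2.1, h.1.1.1, h.1.1.2.2⟩, isPlacement_swap12.2 h.1.2⟩,
      h.2.2.1, h.2.1, h.2.2.2⟩
  · rintro ⟨a, b, c⟩ h
    rw [Finset.mem_coe, Finset.mem_filter, mem_placements] at h ⊢
    simp only [pattern, Prod.mk.injEq] at h ⊢
    exact ⟨⟨⟨h.1.1.2.1, h.1.1.1, h.1.1.2.2⟩, isPlacement_swap12.2 h.1.2⟩,
      h.2.2.1, h.2.1, h.2.2.2⟩
  · rintro ⟨a, b, c⟩ _; rfl
  · rintro ⟨a, b, c⟩ _; rfl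

/-- The pattern count is symmetric under exchanging the last two copies. -/
lemma patCount_swap23 (ends : E → Sym2 V) (L : Finset E) (τ : E → ℕ) (s t : V) (p q r : Bool) :
    patCount ends L τ s t (p, r, q) = patCount ends L τ s t (p, q, r) := by
  unfold patCount
  refine Finset.card_nbij' (fun x => (x.1, x.2.2, x.2.1)) (fun x => (x.1, x.2.2, x.2.1)) ?_ ?_ ?_ ?_
  · rintro ⟨a, b, c⟩ h
    rw [Finset.mem_coe, Finset.mem_filter, mem_placements] at h ⊢
    simp only [pattern, Prod.mk.injEq] at h ⊢
    exact ⟨⟨⟨h.1.1.1, h.1.1.2.2, h.1.1.2.1⟩, isPlacement_swap23.2 h.1.2⟩,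
      h.2.1, h.2.2.2, h.2.2.1⟩
  · rintro ⟨a, b, c⟩ h
    rw [Finset.mem_coe, Finset.mem_filter, mem_placements] at h ⊢
    simp only [pattern, Prod.mk.injEq] at h ⊢
    exact ⟨⟨⟨h.1.1.1, h.1.1.2.2, h.1.1.2.1⟩, isPlacement_swap23.2 h.1.2⟩,
      h.2.1, h.2.2.2, h.2.2.1⟩
  · rintro ⟨a, b, c⟩ _; rfl
  · rintro ⟨a, b, c⟩ _; rfl

/-- The pattern count depends only on the number of joined copies. -/
lemma patCount_eq_coeff (ends : E → Sym2 V) (L : Finset E) (τ : E → ℕ) (s t : V) (p q r : Bool) :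
    patCount ends L τ s t (p, q, r) = twoTermCoeff ends L τ s t (p.toNat + q.toNat + r.toNat) := by
  unfold twoTermCoeff
  cases p <;> cases q <;> cases r
  · rfl
  · rw [← patCount_swap23, ← patCount_swap12]; rfl
  · rw [← patCount_swap12]; rfl
  · rw [← patCount_swap12, ← patCount_swap23]; rfl
  · rfl
  · rw [← patCount_swap23]; rfl
  · rfl
  · rfl

variable {R : Type*} [CommRing R]

/-- The placement sum of a function of the joined-copy pattern, grouped by the pattern. -/
lemma sum_placements_pattern (ends : E → Sym2 V) (L : Finset E) (τ : E → ℕ) (s t : V)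
    (T : Bool → Bool → Bool → R) :
    (∑ a ∈ suppL L, ∑ b ∈ suppL L, ∑ c ∈ suppL L,
        if IsPlacement L τ a b c then T (joined ends s t a) (joined ends s t b) (joined ends s t c)
        else 0) =
      ∑ pqr : Bool × Bool × Bool, (patCount ends L τ s t pqr : R) * T pqr.1 pqr.2.1 pqr.2.2 := by
  have h1 : (∑ a ∈ suppL L, ∑ b ∈ suppL L, ∑ c ∈ suppL L,
      if IsPlacement L τ a b c then T (joined ends s t a) (joined ends s t b) (joined ends s t c)
      else 0) = ∑ p ∈ placements L τ, T (pattern ends s t p).1 (pattern ends s t p).2.1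
        (pattern ends s t p).2.2 := by
    unfold placements
    rw [Finset.sum_filter, Finset.sum_product]
    refine Finset.sum_congr rfl fun a _ => ?_
    rw [Finset.sum_product]
    rfl
  rw [h1, ← Finset.sum_fiberwise_of_maps_to (t := (Finset.univ : Finset (Bool × Bool × Bool)))
    (g := pattern ends s t) (fun _ _ => Finset.mem_univ _)]
  refine Finset.sum_congr rfl fun pqr _ => ?_
  rw [Finset.sum_congr rfl fun p hp => by
    rw [(Finset.mem_filter.1 hp).2]]
  rw [Finset.sum_const, nsmul_eq_mul]
  rfl

/-- Grouping the eight patterns by their weight. -/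
lemma sum_pattern_weight (c : ℕ → ℕ) (T : Bool → Bool → Bool → R) :
    (∑ pqr : Bool × Bool × Bool, ((c (pqr.1.toNat + pqr.2.1.toNat + pqr.2.2.toNat) : ℕ) : R) *
        T pqr.1 pqr.2.1 pqr.2.2) =
      ∑ k ∈ Finset.range 4, ((c k : ℕ) : R) * ∑ p : Bool, ∑ q : Bool, ∑ r : Bool,
        if p.toNat + q.toNat + r.toNat = k then T p q r else 0 := by
  rw [Fintype.sum_prod_type]
  simp only [Fintype.sum_prod_type, Fintype.sum_bool, Finset.sum_range_succ, Finset.sum_range_zero]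
  simp
  ring

end Pattern

/-! ## The identity -/

section Identity

open Classical OneTyped

variable {V : Type*} {E : Type*} [Fintype E] [DecidableEq E] {R : Type*} [Field R]

/-- **The two-terminal lemma for the crux kernel** (mine-1 §26(e)): a typed subgraph `H` = the
edges `L ⊆ F` with both ends in `I ∪ {s, t}` (`I` unmarked and internal: every other edge at a
vertex of `I` is untyped and pinned closed) contributes to the typed base exactly as a single
`s`–`t` edge of type `k` with the nonnegative integer multiplicity `c_k = twoTermCoeff … k` = the
number of typed placements of `L` joining `s, t` in exactly `k` (fixed) copies:
`N(B + H) = Σ_{k ≤ 3} c_k · N(B + s–t(k))`, the edge `h₀ ∈ L` re-attached to `s(s, t)` and re-typed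
`k`, the rest of `L` deleted. `k = 0` is the deletion, `k = 3` the contraction; the series and
parallel rules are the cases `|I| = 1` / `I = ∅`. -/
theorem typedCount_twoTerminal (ends : E → Sym2 V) (o a₁ a₂ a₃ b : V) {I : Set V} {s t : V}
    (hs : s ∉ I) (ht : t ∉ I) (hI : ∀ v ∈ I, v ≠ o ∧ v ≠ a₁ ∧ v ≠ a₂ ∧ v ≠ a₃ ∧ v ≠ b)
    {L : Finset E} (hLI : ∀ e ∈ L, ∀ v ∈ ends e, v ∈ I ∨ v = s ∨ v = t) {h₀ : E} (h₀L : h₀ ∈ L)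
    {F : Finset E} (hLF : L ⊆ F) (z : Config E) (τ : E → ℕ)
    (hcl : ∀ e, e ∉ L → (∃ v ∈ I, v ∈ ends e) → e ∉ F ∧ z e = false) :
    typedCount F z τ (K3 ends o a₁ a₂ a₃ b : Config E → Config E → Config E → R) =
      ∑ k ∈ Finset.range 4, (twoTermCoeff ends L τ s t k : R) *
        typedCount (insert h₀ (F \ L)) (offL L z) (Function.update τ h₀ k)
          (K3 (Function.update ends h₀ s(s, t)) o a₁ a₂ a₃ b) := by
  set ends' := Function.update ends h₀ s(s, t) with hends'
  have hh₀ : h₀ ∉ F \ L := fun h => (Finset.mem_sdiff.1 h).2 h₀L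
  -- the pieces
  set T : Bool → Bool → Bool → R := fun p q r =>
    typedCount (F \ L) (offL L z) τ (fun x y w => K3 ends' o a₁ a₂ a₃ b
      (Function.update x h₀ p) (Function.update y h₀ q) (Function.update w h₀ r)) with hT
  -- the kernel at a placement is the kernel of the virtual edge
  have hK : ∀ a b' c : Config E, a ∈ suppL L → b' ∈ suppL L → c ∈ suppL L →
      typedCount (F \ L) (offL L z) τ (fun x y w => K3 ends o a₁ a₂ a₃ b
        (patchL L a x) (patchL L b' y) (patchL L c w)) =
      T (joined ends s t a) (joined ends s t b') (joined ends s t c) := by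
    intro a b' c ha hb hc
    rw [hT]
    refine typedCount_congr_K_on _ _ _ fun x y w hxyw _ => ?_
    -- closedness on `L` and on the pinned-closed edges at `I`, from the support
    have hsupp : ∀ a' x' : Config E, (∀ e, e ∉ F \ L → x' e = offL L z e) →
        (∀ e ∈ L, x' e = false) ∧
          ∀ e, e ∉ L → (∃ v ∈ I, v ∈ ends e) → patchL L a' x' e = false := by
      intro a' x' hx'
      refine ⟨fun e he => ?_, fun e heL hv => ?_⟩
      · have := hx' e fun h => (Finset.mem_sdiff.1 h).2 he
        rwa [offL_of_mem he] at this
      · obtain ⟨heF, hze⟩ := hcl e heL hv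
        rw [patchL_of_not_mem heL, hx' e fun h => heF (Finset.mem_sdiff.1 h).1,
          offL_of_not_mem heL, hze]
    have hx := hsupp a x fun e he => (hxyw e he).1
    have hy := hsupp b' y fun e he => (hxyw e he).2.1
    have hw := hsupp c w fun e he => (hxyw e he).2.2
    rw [K3_eq_KB, K3_eq_KB]
    have hst : ∀ (a' : Config E) (x' : Config E), a' ∈ suppL L → (∀ e ∈ L, x' e = false) →
        (∀ e, e ∉ L → (∃ v ∈ I, v ∈ ends e) → patchL L a' x' e = false) →
        st ends o a₁ a₂ a₃ b (patchL L a' x') =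
          st ends' o a₁ a₂ a₃ b (Function.update x' h₀ (joined ends s t a')) := by
      intro a' x' ha' hx' hcl'
      have hj : joined ends s t a' = true ↔ Conn ends (onL L (patchL L a' x')) s t := by
        rw [onL_patchL (mem_suppL.1 ha'), joined, decide_eq_true_iff]
      have := st_twoTerminal ends o a₁ a₂ a₃ b hs ht hI hLI h₀L (patchL L a' x') hcl' hj
      rwa [offL_patchL _ hx'] at this
    rw [hst a x ha hx.1 hx.2, hst b' y hb hy.1 hy.2, hst c w hc hw.1 hw.2]
  -- the right-hand pieces
  have hR : ∀ k : ℕ, typedCount (insert h₀ (F \ L)) (offL L z) (Function.update τ h₀ k)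
      (K3 ends' o a₁ a₂ a₃ b : Config E → Config E → Config E → R) =
      ∑ p : Bool, ∑ q : Bool, ∑ r : Bool,
        if p.toNat + q.toNat + r.toNat = k then T p q r else 0 := by
    intro k
    rw [typedCount_split (insert h₀ (F \ L)) h₀ (Finset.mem_insert_self _ _)]
    refine Finset.sum_congr rfl fun p _ => Finset.sum_congr rfl fun q _ =>
      Finset.sum_congr rfl fun r _ => ?_
    rw [Function.update_self]
    refine if_congr Iff.rfl ?_ rfl
    rw [hT]
    simp only
    rw [Finset.erase_insert hh₀]
    have hz : Function.update (offL L z) h₀ false = offL L z := by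
      conv_lhs => rw [← offL_of_mem (ω := z) h₀L]
      exact Function.update_eq_self h₀ (offL L z)
    rw [hz]
    refine typedCount_congr_τ _ _ (fun e he => ?_) _
    rw [Function.update_of_ne (fun h => hh₀ (by rw [← h]; exact he))]
  -- assembly
  have hmid : (∑ a ∈ suppL L, ∑ b' ∈ suppL L, ∑ c ∈ suppL L,
      if IsPlacement L τ a b' c then typedCount (F \ L) (offL L z) τ
        (fun x y w => K3 ends o a₁ a₂ a₃ b (patchL L a x) (patchL L b' y) (patchL L c w)) else 0) =
      ∑ a ∈ suppL L, ∑ b' ∈ suppL L, ∑ c ∈ suppL L,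
        if IsPlacement L τ a b' c then
          T (joined ends s t a) (joined ends s t b') (joined ends s t c) else 0 :=
    Finset.sum_congr rfl fun a ha => Finset.sum_congr rfl fun b' hb =>
      Finset.sum_congr rfl fun c hc => by
        by_cases hP : IsPlacement L τ a b' c
        · rw [if_pos hP, if_pos hP, hK a b' c ha hb hc]
        · rw [if_neg hP, if_neg hP]
  have hpat : (∑ pqr : Bool × Bool × Bool, (patCount ends L τ s t pqr : R) * T pqr.1 pqr.2.1 pqr.2.2) =
      ∑ pqr : Bool × Bool × Bool,
        ((twoTermCoeff ends L τ s t (pqr.1.toNat + pqr.2.1.toNat + pqr.2.2.toNat) : ℕ) : R) *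
          T pqr.1 pqr.2.1 pqr.2.2 :=
    Finset.sum_congr rfl fun pqr _ => by
      obtain ⟨p, q, r⟩ := pqr
      rw [patCount_eq_coeff]
  rw [typedCount_split_finset F L hLF z τ, hmid, sum_placements_pattern ends L τ s t T, hpat,
    sum_pattern_weight (twoTermCoeff ends L τ s t) T]
  simp only [hR]

end Identity

/-! ## The reduction rule -/

section Reduction

open Classical

variable {V : Type*} {E : Type*} [Fintype E] [DecidableEq E] {R : Type*} [Field R] [LinearOrder R]
  [IsStrictOrderedRing R]

/-- **The two-terminal reduction** (the rule of the calculus): row 2′TRI on the four instances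
`B + s–t(k)`, `k ≤ 3`, gives it on `B + H` — the coefficients `c_k` are nonnegative integers.
With `|L| ≥ 2` the typed set shrinks (`|F ∖ L ∪ {h₀}| < |F|`), so every instance containing a
two-terminal unmarked subgraph reduces to instances with fewer typed edges. -/
theorem typedCount_nonneg_of_twoTerminal (ends : E → Sym2 V) (o a₁ a₂ a₃ b : V) {I : Set V}
    {s t : V} (hs : s ∉ I) (ht : t ∉ I) (hI : ∀ v ∈ I, v ≠ o ∧ v ≠ a₁ ∧ v ≠ a₂ ∧ v ≠ a₃ ∧ v ≠ b)
    {L : Finset E} (hLI : ∀ e ∈ L, ∀ v ∈ ends e, v ∈ I ∨ v = s ∨ v = t) {h₀ : E} (h₀L : h₀ ∈ L)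
    {F : Finset E} (hLF : L ⊆ F) (z : Config E) (τ : E → ℕ)
    (hcl : ∀ e, e ∉ L → (∃ v ∈ I, v ∈ ends e) → e ∉ F ∧ z e = false)
    (h : ∀ k, k ≤ 3 → 0 ≤ typedCount (insert h₀ (F \ L)) (offL L z) (Function.update τ h₀ k)
      (K3 (Function.update ends h₀ s(s, t)) o a₁ a₂ a₃ b : Config E → Config E → Config E → R)) :
    0 ≤ typedCount F z τ (K3 ends o a₁ a₂ a₃ b : Config E → Config E → Config E → R) := by
  rw [typedCount_twoTerminal ends o a₁ a₂ a₃ b hs ht hI hLI h₀L hLF z τ hcl]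
  exact Finset.sum_nonneg fun k hk =>
    mul_nonneg (Nat.cast_nonneg _) (h k (Nat.lt_succ_iff.1 (Finset.mem_range.1 hk)))

omit [Fintype E] in
/-- The typed set of the reduced instance is smaller as soon as `H` has two edges. -/
lemma card_reduced_lt {L F : Finset E} (hLF : L ⊆ F) {h₀ : E} (h₀L : h₀ ∈ L) (h2 : 2 ≤ L.card) :
    (insert h₀ (F \ L)).card < F.card := by
  have hh₀ : h₀ ∉ F \ L := fun h => (Finset.mem_sdiff.1 h).2 h₀L
  rw [Finset.card_insert_of_notMem hh₀, Finset.card_sdiff_of_subset hLF]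
  have := Finset.card_le_card hLF
  omega

end Reduction

end TwoTerm

end TypedRed

end CovForm

end Summit.Ventures.PercRepro2
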